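import Mathlib.Analysis.SpecialFunctions.Pow.Asymptotics
import Mathlib.Analysis.SpecialFunctions.Log.Deriv
import Mathlib.Analysis.SpecialFunctions.Integrals.Basic
import Mathlib.MeasureTheory.Integral.IntervalIntegral.FundThmCalculus
import HarnessLib

/-!
# Route `PrimeLevelFamEdge`, crux K_A `MomentsBeyondDiagonal` (stmt-Parity-20007), line «petersson_layers» v4, stub `stub_diag`:
# **real-variable tools for the small-`y` expansion of the Bose coefficient `c_{a0}` (census R2)**

The R2 target (`Lines/petersson_layers_stub_diag_g6_q1_profile.md`, signature `bose_coeff_a0_leading`) is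
`∫₀^∞ (log u)^a (e^{u+y/u} − 1)⁻¹ du = (−1)^a (log(1/y)/2)^{a+1}/(a+1) + O_a((1 + log(1/y))^a)` for `0 < y ≤ 1`. With the
pointwise structure of the kernel (`…DiagBoseB0Kernel`: kernel `= u/(u²+y) + O(1)` on `(0,1]`, `u/(u²+y) = 1/u − O(y/u³)`,
`≤ u/y`, `≤ 2e^{−u}` on `[1,∞)`) the proof needs the elementary estimates of this file (the tail integral `∫_s^1 y/u³ = y/(2s²) − y/2` is left to the assembly) (`s = √y`):

* `integral_log_pow_div_eq` — **`∫_s^1 (log u)^a du/u = −(log s)^{a+1}/(a+1)`** (`0 < s ≤ 1`; the leading term);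
* `mul_abs_log_pow_le` — `w·|log w|^a ≤ max(a,1)^a` on `(0,1]` (`|log w|·w^{1/a} < a`);
* `abs_log_pow_mul_le` — `|log u|^a·u ≤ 2^a(|log s|^a + max(a,1)^a)·s` for `0 < u ≤ s ≤ 1` (the range below `√y`);
  `abs_log_le_abs_log` — `|log u| ≤ |log s|` for `s ≤ u ≤ 1`.

Def-free; theorems only. Helper `--supports stmt-Parity-20007`; closes nothing; K_A, K_B and the Parity summit are NOT
proved; nothing about Landau–Siegel zeros.

## References
* E. Kowalski, P. Michel, J. VanderKam, J. reine angew. Math. 526 (2000), (22)–(28) pp. 12–15.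
  [cite: KowalskiMichelVanderKam2000, (22)–(28) — derivation (residues of the diagonal cut-off weight)]
-/

noncomputable section

open Real Set MeasureTheory intervalIntegral

namespace Summit.Parity.GeneralizedHardyLittlewood.Theorems.MomentsBeyondDiagonal.DiagLines

/-- **`∫_s^1 (log u)^a du/u = −(log s)^{a+1}/(a+1)`** for `0 < s ≤ 1`. [folklore] -/
theorem integral_log_pow_div_eq (a : ℕ) {s : ℝ} (hs0 : 0 < s) (hs1 : s ≤ 1) :
    ∫ u in s..1, Real.log u ^ a / u = -Real.log s ^ (a + 1) / ((a : ℝ) + 1) := by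
  have ha : ((a : ℝ) + 1) ≠ 0 := by positivity
  have hderiv : ∀ u ∈ uIcc s 1, HasDerivAt (fun u ↦ Real.log u ^ (a + 1) / ((a : ℝ) + 1)) (Real.log u ^ a / u) u := by
    intro u hu
    rw [uIcc_of_le hs1] at hu
    have hu0 : 0 < u := lt_of_lt_of_le hs0 hu.1
    have h := ((Real.hasDerivAt_log hu0.ne').pow (a + 1)).div_const ((a : ℝ) + 1)
    refine h.congr_deriv ?_
    push_cast
    rw [mul_assoc, mul_div_cancel_left₀ _ ha, div_eq_mul_inv]
  have hcont : ContinuousOn (fun u ↦ Real.log u ^ a / u) (uIcc s 1) := by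
    rw [uIcc_of_le hs1]
    refine ContinuousOn.div (ContinuousOn.pow (continuousOn_log.mono fun u hu ↦ ?_) a) continuousOn_id
      fun u hu ↦ ?_
    · exact ne_of_gt (lt_of_lt_of_le hs0 hu.1)
    · exact ne_of_gt (lt_of_lt_of_le hs0 hu.1)
  rw [integral_eq_sub_of_hasDerivAt hderiv (hcont.intervalIntegrable), Real.log_one, zero_pow (Nat.succ_ne_zero a),
    zero_div, zero_sub, neg_div]

/-- **`w·|log w|^a ≤ max(a,1)^a` for `0 < w ≤ 1`** (`|log w|·w^{1/a} < a`). [folklore] -/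
theorem mul_abs_log_pow_le (a : ℕ) {w : ℝ} (hw0 : 0 < w) (hw1 : w ≤ 1) :
    w * |Real.log w| ^ a ≤ (max (a : ℝ) 1) ^ a := by
  rcases Nat.eq_zero_or_pos a with rfl | ha
  · simpa using hw1
  have ha0 : (a : ℝ) ≠ 0 := by positivity
  have h := Real.abs_log_mul_self_rpow_lt w ((a : ℝ)⁻¹) hw0 hw1 (by positivity)
  rw [one_div, inv_inv, abs_mul, abs_of_nonneg (Real.rpow_nonneg hw0.le _)] at h
  -- `(|log w|·w^{1/a})^a = |log w|^a·w`
  have hpow : (|Real.log w| * w ^ ((a : ℝ)⁻¹)) ^ a = |Real.log w| ^ a * w := by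
    rw [mul_pow, Real.rpow_inv_natCast_pow hw0.le ha.ne']
  have h2 : (|Real.log w| * w ^ ((a : ℝ)⁻¹)) ^ a ≤ (a : ℝ) ^ a :=
    pow_le_pow_left₀ (by positivity) h.le a
  rw [hpow] at h2
  calc w * |Real.log w| ^ a = |Real.log w| ^ a * w := mul_comm _ _
    _ ≤ (a : ℝ) ^ a := h2
    _ ≤ (max (a : ℝ) 1) ^ a := pow_le_pow_left₀ (Nat.cast_nonneg a) (le_max_left _ _) a

/-- `|log u| ≤ |log s|` for `0 < s ≤ u ≤ 1`. [folklore] -/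
theorem abs_log_le_abs_log {s u : ℝ} (hs0 : 0 < s) (hsu : s ≤ u) (hu1 : u ≤ 1) :
    |Real.log u| ≤ |Real.log s| := by
  have hu0 : 0 < u := lt_of_lt_of_le hs0 hsu
  rw [abs_of_nonpos (Real.log_nonpos hu0.le hu1), abs_of_nonpos (Real.log_nonpos hs0.le (hsu.trans hu1))]
  exact neg_le_neg (Real.log_le_log hs0 hsu)

/-- **`|log u|^a·u ≤ 2^a·(|log s|^a + max(a,1)^a)·s` for `0 < u ≤ s ≤ 1`** (`|log u| = |log s| + |log(u/s)|` and
`(u/s)|log(u/s)|^a ≤ max(a,1)^a`). [folklore] -/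
theorem abs_log_pow_mul_le (a : ℕ) {s u : ℝ} (hu0 : 0 < u) (hus : u ≤ s) (hs1 : s ≤ 1) :
    |Real.log u| ^ a * u ≤ 2 ^ a * (|Real.log s| ^ a + (max (a : ℝ) 1) ^ a) * s := by
  have hs0 : 0 < s := lt_of_lt_of_le hu0 hus
  set w := u / s with hw
  have hw0 : 0 < w := div_pos hu0 hs0
  have hw1 : w ≤ 1 := (div_le_one hs0).2 hus
  have huw : u = s * w := by rw [hw]; field_simp
  -- `|log u| = |log s| + |log w|`
  have hsplit : |Real.log u| = |Real.log s| + |Real.log w| := by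
    rw [huw, Real.log_mul hs0.ne' hw0.ne', abs_of_nonpos (Real.log_nonpos hs0.le hs1),
      abs_of_nonpos (Real.log_nonpos hw0.le hw1), abs_of_nonpos]
    · ring
    · exact add_nonpos (Real.log_nonpos hs0.le hs1) (Real.log_nonpos hw0.le hw1)
  -- `(x+z)^a ≤ 2^a (x^a + z^a)`
  have hxz : ∀ x z : ℝ, 0 ≤ x → 0 ≤ z → (x + z) ^ a ≤ 2 ^ a * (x ^ a + z ^ a) := by
    intro x z hx hz
    have h1 : x + z ≤ 2 * max x z := by
      rcases le_total x z with h | h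
      · rw [max_eq_right h]; linarith
      · rw [max_eq_left h]; linarith
    have h2 : (max x z) ^ a ≤ x ^ a + z ^ a := by
      rcases le_total x z with h | h
      · rw [max_eq_right h]; linarith [pow_nonneg hx a]
      · rw [max_eq_left h]; linarith [pow_nonneg hz a]
    calc (x + z) ^ a ≤ (2 * max x z) ^ a := pow_le_pow_left₀ (by positivity) h1 a
      _ = 2 ^ a * (max x z) ^ a := mul_pow _ _ _
      _ ≤ 2 ^ a * (x ^ a + z ^ a) := mul_le_mul_of_nonneg_left h2 (by positivity)
  have hmw := mul_abs_log_pow_le a hw0 hw1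
  rw [hsplit, huw]
  calc (|Real.log s| + |Real.log w|) ^ a * (s * w)
      ≤ 2 ^ a * (|Real.log s| ^ a + |Real.log w| ^ a) * (s * w) :=
        mul_le_mul_of_nonneg_right (hxz _ _ (abs_nonneg _) (abs_nonneg _)) (by positivity)
    _ = 2 ^ a * s * (|Real.log s| ^ a * w + w * |Real.log w| ^ a) := by ring
    _ ≤ 2 ^ a * s * (|Real.log s| ^ a * 1 + (max (a : ℝ) 1) ^ a) := by
        gcongr
    _ = 2 ^ a * (|Real.log s| ^ a + (max (a : ℝ) 1) ^ a) * s := by ring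

end Summit.Parity.GeneralizedHardyLittlewood.Theorems.MomentsBeyondDiagonal.DiagLines

end
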